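import Summits.QuantumFields.GaugeBoot.OneOverNFreeEnergy
import HarnessLib

/-!
# The `1/N` expansion of the free energy per site, to all orders: the theorem (gauge-boot, ADDENDUM 30 part L)

HONEST FRAMING (cell `pub-gaugeboot`, page 1 of every file): the venture produces certified bounds
on lattice expectations at stated coupling, gauge group, dimension and torus size; NOT a mass gap,
NOT a continuum limit, NOT a string tension; NOT Yang–Mills-summit-bearing (barriers
`FixedCouplingUltralocality`, `PerturbativeInvisibility`).  Strong-coupling `SO(N)` lattice gauge theory with free boundary
condition (S. Chatterjee, Comm. Math. Phys. **366** (2019); S. Chatterjee, J. Jafarov, arXiv:1604.04777); nothing about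
four-dimensional continuum Yang–Mills or a mass gap.

## Content

★★★ `freeEnergy_expansion_of` / `oneOverN_freeEnergy` — **THE `1/N` EXPANSION OF THE FREE ENERGY PER SITE OF STRONGLY COUPLED
`SO(N)` LATTICE GAUGE THEORY, TO ALL ORDERS** (not in the sources; order zero is Chatterjee's Corollary 3.4): with the lane's
coefficients `f_k` of the `1/N` expansion of Wilson loop expectations (`oneOverN_master`) and `D = d(d−1)/2`, for every `k`, every
`|β| ≤ β₀(d, k+1)`, every sequence of cubes `Λ_N = [−M_N, M_N]^d` with `M_N → ∞` and `N^{k+1}/M_N → 0`, and any plaquette `p`,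

  `N^k · ( log Z_{Λ_N,N,β} / (N² |Λ_N|) − Σ_{i<k} N^{−i} · D ∫₀^β f_i(t, (∂p)) dt ) ⟶ D ∫₀^β f_k(t, (∂p)) dt`  (`N → ∞`),

i.e. `log Z_{Λ_N,N,β}/(N²|Λ_N|) = Σ_{i=0}^{k} N^{−i} (d(d−1)/2) ∫₀^β f_i(t,(∂p)) dt + o(N^{−k})`.  Proof: `log Z = N² ∫₀^β Σ_q φ_t((∂q)) dt`
(sibling `LogPartitionFunction`), the uniform plaquette-average estimate of the sibling `OneOverNFreeEnergy` and
`|∫₀^β (h_N − D f_k)| ≤ ε_N |β|`.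

Everything is `[folklore]` given the siblings.
-/

noncomputable section

open Filter Topology MeasureTheory
open Literature.Probability.LatticeModels (Site box)
open Literature.MathematicalPhysics.QuantumLattice (ZdEdge ZdPlaquette)
open Literature.MathematicalPhysics.QuantumFieldTheory (latticeNorm plaquettesIn)
open Literature.MathematicalPhysics.QuantumFieldTheory.Chatterjee2019LargeN
open Literature.MathematicalPhysics.QuantumFieldTheory.Chatterjee2019LargeN.CoeffCatalanBoundProof

namespace Summit.QuantumFields.GaugeBoot

namespace StringDuality

variable (d : ℕ)

/-- ★★★ **The `1/N` expansion of the free energy per site, to all orders**, for any family `F` with the order-by-order properties of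
the lane's expansion (convergence along super-logarithmic cubes, bounds, uniform finite-volume bounds, plaquette independence).
[cite: Chatterjee2019LargeN, Corollary 3.4, §15; ChatterjeeJafarov2016OneOverN, Theorem 3.1] -/
theorem freeEnergy_expansion_of {F : ℕ → ℝ → LoopSeq d → ℝ} {β₀ C L : ℕ → ℝ}
    (hanti : ∀ k, β₀ (k + 1) ≤ β₀ k) (hC : ∀ k, 0 ≤ C k) (hL : ∀ k, 1 ≤ L k)
    (hB : ∀ (k : ℕ) (β : ℝ), |β| ≤ β₀ k → ∀ s : LoopSeq d, IsLoopSeq s → |F (k + 2) β s| ≤ C k * L k ^ s.len)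
    (hConv : ∀ (k : ℕ) (β : ℝ), |β| ≤ β₀ k → ∀ M : ℕ → ℕ, (∀ a : ℕ, ∀ᶠ N : ℕ in atTop, a * Nat.log 2 N ≤ M N) →
      ∀ s : LoopSeq d, IsLoopSeq s → Tendsto (fun N : ℕ => (N : ℝ) ^ k *
        (phi N β (box d (M N)) s - ∑ i ∈ Finset.range k, F (i + 2) β s / (N : ℝ) ^ i)) atTop (𝓝 (F (k + 2) β s)))
    (hQ : ∀ (k : ℕ) (β : ℝ), |β| ≤ β₀ k → ∀ (Λ : Finset (Site d)) (N : ℕ), 2 ≤ N → ∀ s : LoopSeq d, IsLoopSeq s →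
      (∀ l ∈ s, ∀ e ∈ l, ∀ v : Site d,
        latticeNorm (v - DEdge.src e) ≤ ((k * (4 * (Nat.log 2 N + 3)) : ℕ) : ℝ) ∨
          latticeNorm (v - DEdge.tgt e) ≤ ((k * (4 * (Nat.log 2 N + 3)) : ℕ) : ℝ) → v ∈ Λ) →
      |(N : ℝ) ^ k * (phi N β Λ s - ∑ i ∈ Finset.range k, F (i + 2) β s / (N : ℝ) ^ i)| ≤ C k * L k ^ s.len)
    (hPI : ∀ (k : ℕ) (β : ℝ), |β| ≤ β₀ (k + 1) → ∀ p q : ZdPlaquette d,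
      F (k + 2) β [plaquetteWord p] = F (k + 2) β [plaquetteWord q])
    (k : ℕ) {β : ℝ} (hβ : |β| ≤ β₀ (k + 1)) {M : ℕ → ℕ} (hM' : Tendsto M atTop atTop)
    (hM : Tendsto (fun N : ℕ => (N : ℝ) ^ (k + 1) / (M N : ℝ)) atTop (𝓝 0)) (p : ZdPlaquette d) :
    Tendsto (fun N : ℕ => (N : ℝ) ^ k *
        (Real.log (soPartitionFunction N β (box d (M N))) / ((N : ℝ) ^ 2 * (box d (M N)).card)
          - ∑ i ∈ Finset.range k,
              ((d : ℝ) * ((d : ℝ) - 1) / 2 * ∫ t in (0 : ℝ)..β, F (i + 2) t [plaquetteWord p]) / (N : ℝ) ^ i)) atTop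
      (𝓝 ((d : ℝ) * ((d : ℝ) - 1) / 2 * ∫ t in (0 : ℝ)..β, F (k + 2) t [plaquetteWord p])) := by
  obtain ⟨ε, hε, hAVG⟩ := avg_uniform_estimate d hanti hC hL hB hQ hPI k p hM' hM
  set D : ℝ := (d : ℝ) * ((d : ℝ) - 1) / 2 with hDdef
  -- the averaged plaquette values and `log Z = N² |Λ| ∫ g`
  set g : ℕ → ℝ → ℝ := fun N t => (∑ q ∈ plaquettesIn (box d (M N)),
      (if h : q.2.1 < q.2.2 then phi N t (box d (M N)) [plaquetteWord ⟨q.1, ⟨(q.2.1, q.2.2), h⟩⟩] else 0)) /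
        (box d (M N)).card with hg
  have hlog : ∀ N : ℕ, N ≠ 0 →
      Real.log (soPartitionFunction N β (box d (M N))) / ((N : ℝ) ^ 2 * (box d (M N)).card) =
        ∫ t in (0 : ℝ)..β, g N t := by
    intro N hN
    have hb : (0 : ℝ) < (box d (M N)).card := by exact_mod_cast card_box_pos (M N)
    have hN2 : (N : ℝ) ^ 2 ≠ 0 := by positivity
    rw [log_soPartitionFunction_eq_integral_phi N hN]
    have hsum' : ∀ t : ℝ, (∑ q ∈ (plaquettesIn (box d (M N))).attach,
        phi N t (box d (M N)) [plaquetteWord ⟨q.1.1, ⟨(q.1.2.1, q.1.2.2), (Iff.mp SOMasterLoop.mem_plaquettesIn_iff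
          (show ((q.1.1, q.1.2.1, q.1.2.2) : Site d × Fin d × Fin d) ∈ plaquettesIn (box d (M N)) from q.2)).1⟩⟩]) =
        ∑ q ∈ plaquettesIn (box d (M N)),
          (if h : q.2.1 < q.2.2 then phi N t (box d (M N)) [plaquetteWord ⟨q.1, ⟨(q.2.1, q.2.2), h⟩⟩] else 0) := by
      intro t
      rw [← Finset.sum_attach (plaquettesIn (box d (M N))) (fun q =>
        (if h : q.2.1 < q.2.2 then phi N t (box d (M N)) [plaquetteWord ⟨q.1, ⟨(q.2.1, q.2.2), h⟩⟩] else 0))]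
      refine Finset.sum_congr rfl fun q _ => ?_
      rw [dif_pos (Iff.mp SOMasterLoop.mem_plaquettesIn_iff
        (show ((q.1.1, q.1.2.1, q.1.2.2) : Site d × Fin d × Fin d) ∈ plaquettesIn (box d (M N)) from q.2)).1]
    simp_rw [hsum']
    rw [intervalIntegral.integral_const_mul, hg]
    simp_rw [div_eq_mul_inv]
    rw [intervalIntegral.integral_mul_const]
    field_simp
  have hgcont : ∀ N : ℕ, Continuous (g N) := by
    intro N
    rw [hg]
    refine Continuous.div_const (continuous_finsetSum _ fun q _ => ?_) _
    split_ifs with h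
    · exact continuous_phi_coupling N (box d (M N)) _
    · exact continuous_const
  -- integrability of the coefficients
  have hIi : ∀ i, i ≤ k + 1 → IntervalIntegrable (fun t : ℝ => F (i + 2) t [plaquetteWord p]) volume 0 β :=
    fun i hi => intervalIntegrable_coeff hanti hConv hB i β (hβ.trans (antitone_of_succ_le hanti hi)) p
  -- the integrand `h_N` and its integral
  have hkey : ∀ N : ℕ, N ≠ 0 →
      (N : ℝ) ^ k * (Real.log (soPartitionFunction N β (box d (M N))) / ((N : ℝ) ^ 2 * (box d (M N)).card)
        - ∑ i ∈ Finset.range k, (D * ∫ t in (0 : ℝ)..β, F (i + 2) t [plaquetteWord p]) / (N : ℝ) ^ i)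
        - D * ∫ t in (0 : ℝ)..β, F (k + 2) t [plaquetteWord p] =
      ∫ t in (0 : ℝ)..β, ((N : ℝ) ^ k * (g N t - D * ∑ i ∈ Finset.range k, F (i + 2) t [plaquetteWord p] / (N : ℝ) ^ i)
        - D * F (k + 2) t [plaquetteWord p]) := by
    intro N hN
    have hgi : IntervalIntegrable (g N) volume 0 β := (hgcont N).intervalIntegrable _ _
    have hterm : ∀ i ∈ Finset.range k,
        IntervalIntegrable (fun t : ℝ => F (i + 2) t [plaquetteWord p] / (N : ℝ) ^ i) volume 0 β := fun i hi =>
      (hIi i (by have := Finset.mem_range.mp hi; omega)).div_const _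
    have hSi : IntervalIntegrable (fun t : ℝ => ∑ i ∈ Finset.range k, F (i + 2) t [plaquetteWord p] / (N : ℝ) ^ i)
        volume 0 β := by
      have e : (fun t : ℝ => ∑ i ∈ Finset.range k, F (i + 2) t [plaquetteWord p] / (N : ℝ) ^ i) =
          ∑ i ∈ Finset.range k, fun t : ℝ => F (i + 2) t [plaquetteWord p] / (N : ℝ) ^ i := by
        funext t; simp only [Finset.sum_apply]
      rw [e]; exact IntervalIntegrable.sum _ hterm
    have hDSi := hSi.const_mul D
    have hinner := (hgi.sub hDSi).const_mul ((N : ℝ) ^ k)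
    have hfk := (hIi k (Nat.le_succ k)).const_mul D
    rw [intervalIntegral.integral_sub hinner hfk, intervalIntegral.integral_const_mul, intervalIntegral.integral_const_mul,
      intervalIntegral.integral_sub hgi hDSi, intervalIntegral.integral_const_mul, intervalIntegral.integral_finsetSum hterm,
      ← hlog N hN]
    simp only [intervalIntegral.integral_div]
    rw [Finset.mul_sum]
    congr 1
    congr 1
    congr 1
    refine Finset.sum_congr rfl fun i _ => ?_
    ring
  -- the estimate `|∫ (h_N − D f_k)| ≤ ε_N |β|`
  rw [Metric.tendsto_atTop]
  intro δ hδ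
  have hε' : ∀ᶠ N : ℕ in atTop, ε N * |β| < δ := by
    have h := hε.mul_const |β|
    rw [zero_mul] at h
    exact h.eventually (gt_mem_nhds hδ)
  obtain ⟨N₀, hN₀⟩ := eventually_atTop.mp ((eventually_ge_atTop 1).and (hAVG.and hε'))
  refine ⟨N₀, fun N hN => ?_⟩
  obtain ⟨hN1, hA, hεN⟩ := hN₀ N hN
  rw [Real.dist_eq, hkey N (by omega)]
  have hbound : ∀ t ∈ Set.uIoc (0 : ℝ) β,
      ‖(N : ℝ) ^ k * (g N t - D * ∑ i ∈ Finset.range k, F (i + 2) t [plaquetteWord p] / (N : ℝ) ^ i)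
        - D * F (k + 2) t [plaquetteWord p]‖ ≤ ε N := by
    intro t ht
    rw [Real.norm_eq_abs]
    exact hA t ((abs_le_of_mem_uIoc ht).trans hβ)
  have h := intervalIntegral.norm_integral_le_of_norm_le_const hbound
  rw [Real.norm_eq_abs, sub_zero] at h
  exact lt_of_le_of_lt h hεN

/-- ★★★ **The `1/N` expansion of the free energy per site of strongly coupled `SO(N)` lattice gauge theory, to all orders**,
packaged with the lane's coefficients: for `d ≥ 2` there are `β₀(d,0) ≥ β₀(d,1) ≥ ⋯ > 0` and ONE family `F` (`f_k = F_{k+2}`,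
`F₀ = F₁ = 0`) — the coefficients of the `1/N` expansion of Wilson loop expectations (`oneOverN_master`: convergence along
super-logarithmic cubes, `f_0 = Σ_X w_β(X)`) — whose plaquette values do not depend on the plaquette, such that for every `k`,
`|β| ≤ β₀(d,k+1)`, cubes with `M_N → ∞`, `N^{k+1}/M_N → 0`, and any plaquette `p`:
`N^k(log Z_{Λ_N,N,β}/(N²|Λ_N|) − Σ_{i<k} N^{−i} (d(d−1)/2)∫₀^β f_i(t,(∂p))dt) → (d(d−1)/2)∫₀^β f_k(t,(∂p))dt`.
[cite: Chatterjee2019LargeN, Corollary 3.4; ChatterjeeJafarov2016OneOverN, Theorem 3.1] -/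
theorem oneOverN_freeEnergy (hd : 2 ≤ d) :
    ∃ β₀ : ℕ → ℝ, (∀ k, 0 < β₀ k) ∧ (∀ k, β₀ (k + 1) ≤ β₀ k) ∧ ∃ F : ℕ → ℝ → LoopSeq d → ℝ,
      (∀ (β : ℝ) (u : LoopSeq d), F 0 β u = 0) ∧ (∀ (β : ℝ) (u : LoopSeq d), F 1 β u = 0) ∧
      (∀ (k : ℕ) (β : ℝ), |β| ≤ β₀ k → ∀ M : ℕ → ℕ, (∀ a : ℕ, ∀ᶠ N : ℕ in atTop, a * Nat.log 2 N ≤ M N) →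
        ∀ s : LoopSeq d, IsLoopSeq s → Tendsto (fun N : ℕ => (N : ℝ) ^ k *
          (phi N β (box d (M N)) s - ∑ i ∈ Finset.range k, F (i + 2) β s / (N : ℝ) ^ i)) atTop (𝓝 (F (k + 2) β s))) ∧
      (∀ β : ℝ, |β| ≤ β₀ 0 → ∀ s : LoopSeq d, IsLoopSeq s → F 2 β s = ∑' X : Trajectory s, X.weight β) ∧
      (∀ (k : ℕ) (β : ℝ), |β| ≤ β₀ (k + 1) → ∀ p q : ZdPlaquette d,
        F (k + 2) β [plaquetteWord p] = F (k + 2) β [plaquetteWord q]) ∧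
      (∀ (k : ℕ) (β : ℝ), |β| ≤ β₀ (k + 1) → ∀ M : ℕ → ℕ, Tendsto M atTop atTop →
        Tendsto (fun N : ℕ => (N : ℝ) ^ (k + 1) / (M N : ℝ)) atTop (𝓝 0) → ∀ p : ZdPlaquette d,
        Tendsto (fun N : ℕ => (N : ℝ) ^ k *
            (Real.log (soPartitionFunction N β (box d (M N))) / ((N : ℝ) ^ 2 * (box d (M N)).card)
              - ∑ i ∈ Finset.range k,
                  ((d : ℝ) * ((d : ℝ) - 1) / 2 * ∫ t in (0 : ℝ)..β, F (i + 2) t [plaquetteWord p]) / (N : ℝ) ^ i)) atTop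
          (𝓝 ((d : ℝ) * ((d : ℝ) - 1) / 2 * ∫ t in (0 : ℝ)..β, F (k + 2) t [plaquetteWord p]))) := by
  obtain ⟨β₀, hpos, hanti, C, L, hC, hL, F, hF0, hF1, HA, HB, -⟩ := oneOverN_master d hd
  have hB : ∀ (k : ℕ) (β : ℝ), |β| ≤ β₀ k → ∀ s : LoopSeq d, IsLoopSeq s → |F (k + 2) β s| ≤ C k * L k ^ s.len :=
    fun k β hβ => (HA k β hβ).2.1
  have hConv : ∀ (k : ℕ) (β : ℝ), |β| ≤ β₀ k → ∀ M : ℕ → ℕ, (∀ a : ℕ, ∀ᶠ N : ℕ in atTop, a * Nat.log 2 N ≤ M N) →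
      ∀ s : LoopSeq d, IsLoopSeq s → Tendsto (fun N : ℕ => (N : ℝ) ^ k *
        (phi N β (box d (M N)) s - ∑ i ∈ Finset.range k, F (i + 2) β s / (N : ℝ) ^ i)) atTop (𝓝 (F (k + 2) β s)) :=
    fun k β hβ => (HA k β hβ).2.2.2.1
  have hQ : ∀ (k : ℕ) (β : ℝ), |β| ≤ β₀ k → ∀ (Λ : Finset (Site d)) (N : ℕ), 2 ≤ N → ∀ s : LoopSeq d, IsLoopSeq s →
      (∀ l ∈ s, ∀ e ∈ l, ∀ v : Site d,
        latticeNorm (v - DEdge.src e) ≤ ((k * (4 * (Nat.log 2 N + 3)) : ℕ) : ℝ) ∨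
          latticeNorm (v - DEdge.tgt e) ≤ ((k * (4 * (Nat.log 2 N + 3)) : ℕ) : ℝ) → v ∈ Λ) →
      |(N : ℝ) ^ k * (phi N β Λ s - ∑ i ∈ Finset.range k, F (i + 2) β s / (N : ℝ) ^ i)| ≤ C k * L k ^ s.len :=
    fun k β hβ => (HA k β hβ).2.2.2.2.2
  have hPI := plaquette_independence_of hd hanti hQ
  exact ⟨β₀, hpos, hanti, F, hF0, hF1, hConv, HB, hPI, fun k β hβ M hM' hM p =>
    freeEnergy_expansion_of d hanti hC hL hB hConv hQ hPI k hβ hM' hM p⟩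

end StringDuality

end Summit.QuantumFields.GaugeBoot

end
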